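import Literature.Geometry.Lorentzian.KerrPeel
import Literature.Geometry.Lorentzian.KerrHawkingField
import HarnessLib

/-!
# The Hawking field, the outgoing null direction and the bulk vector on the Kerr horizon collar

Rest-frame Kerr–Schild algebra for the SLOPE FIELD on the two-sided horizon collar of a sub-extremal
Kerr black hole (`|a| < M`), in ingoing Kerr–Schild Cartesian coordinates (Visser arXiv:0706.0622,
(32)–(35)); everything here is exact Kerr and fully proved:

* §2 the Hawking Killing field `K = ∂₀ + ω₊(x₁∂₂ − x₂∂₁)` (`Kerr.hawkingVector` of
  `KerrHawkingField`; DRSR arXiv:1402.7034, §2.2.2): components, norms, `dr(K⃗) = 0`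
  (`radiusGrad_spatial_hawkingVector`), the horizon identities `g_{r₊}(K, K) = 0` and
  `g_{r₊}(K, u) = (Σ/(r₊² + a²))·dr(u⃗)` for `u⁰ = 0` (`bilin_hawkingVector_of_radius_eq`: the null
  cone is tangent to the horizon along the generator), and the quantitative red shift
  «KerrHorizonRedShiftLinear» `bilin_hawkingVector_self_le_linear`: for `|a| < M` there are
  `d₀, c₀ > 0` with `g_{M,a}(K, K) ≤ −c₀ (r − r₊)` on `r₊ ≤ r ≤ r₊ + d₀` (DRSR Lemma 4.7.2 made
  quantitative: positivity of the surface gravity, via `Kerr.hawking_rho_sq_mul_eq`,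
  `Kerr.hawking_F_factor`);
* the outgoing spatial null direction `n = (0, ℓ⃗)` (`nvec`; Visser (34)): `‖n‖ = 1`,
  `r(q + s n) = r(q) + s`, `dr(n⃗) = 1`, `g_{r₊}(K, n) = Σ/(r₊² + a²) > 0`
  (`bilin_hawkingVector_nvec_pos_of_radius_eq`, the cross term with the bad sign);
* §3 the bulk vector `u = V + (4HΣ/Δ)·W` (`bulkVec`; `V = −g♯dt*`, `W = g♯dr`):
  `g(u, u) = −1 − 2H − 8H²Σ²/(ρ²Δ) ≤ −1 − 2H`, `dr(u⃗) = 2H`, continuity, `Δ ≥ (r₊ − r₋)(r − r₊)`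
  (`delta_ge`, O'Neill 1995, §2.5);
* §4 the radius differential as a Fréchet derivative (`fderiv_radius_apply`, `contDiffAt_fderiv_radius`)
  and the time-normalised outgoing ray `s ↦ q + s n` through a collar point (`tn_ray_mem_shell`,
  `segment_ray_subset_shell`, `norm_hawkingVector_sub_foot`).

These feed `KerrSlopeEngine` (`bulk_slope`, `layer_slope`, `collarSlope_model`).
Provenance: decomp-fsc lens-3 g34 side file `CollarSlope34.lean` ll. 480–968 and 1158–1221 (namespace
`KerrSlope`, farm-checked there), re-homed verbatim on top of `KerrPeel` (shared §1 helpers imported,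
not copied; docstrings/cite tags completed).  References: Dafermos–Rodnianski–Shlapentokh-Rothman
arXiv:1402.7034 (Ann. Math. 183 (2016)), §2.2.2, Lemma 4.7.2; Kerr–Schild 1965; Visser
arXiv:0706.0622, (32)–(35); O'Neill 1995, §2.5.

NOT here: the slope-field engines (`KerrSlopeEngine`), the anchor (`KerrAnchor`), the climb
(`KerrPeelClimb`), anything route-side.
-/

noncomputable section

open scoped Topology Manifold ContDiff ENNReal
open Filter Set Function

namespace Literature.Geometry.Lorentzian

namespace KerrSlope

open Metric KerrPeel

-- typeclass search through nested operator types `E4 →L[ℝ] E4 →L[ℝ] ℝ` (as in `BoostedKerrCausalLegs`)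
set_option maxSynthPendingDepth 3

variable {M a : ℝ} {x : E4}

/-! ### §2 The Hawking field `K = ∂₀ + ω₊(x₁∂₂ − x₂∂₁)`: components, norms, the horizon red-shift «KerrHorizonRedShiftLinear», tangency of the null cone along the generator, and the outgoing spatial null direction `n = (0, ℓ⃗)` -/

/-- `(x₁∂₂ − x₂∂₁)¹ = −x²` (the axial Killing field `Φ` in Kerr–Schild Cartesian components). [cite: DafermosRodnianskiShlapentokhrothman2014, §2.2.2] -/
theorem axialVector_apply_one (x : E4) : Kerr.axialVector x 1 = -x 2 := by
  simp [Kerr.axialVector]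

/-- `(x₁∂₂ − x₂∂₁)² = x¹`. [cite: DafermosRodnianskiShlapentokhrothman2014, §2.2.2] -/
theorem axialVector_apply_two (x : E4) : Kerr.axialVector x 2 = x 1 := by
  simp [Kerr.axialVector]

/-- `(x₁∂₂ − x₂∂₁)³ = 0`. [cite: DafermosRodnianskiShlapentokhrothman2014, §2.2.2] -/
theorem axialVector_apply_three (x : E4) : Kerr.axialVector x 3 = 0 := by
  simp [Kerr.axialVector]

/-- The axial field is linear: `Φ(x) − Φ(y) = Φ(x − y)`. [cite: DafermosRodnianskiShlapentokhrothman2014, §2.2.2] -/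
theorem axialVector_sub (x y : E4) : Kerr.axialVector x - Kerr.axialVector y = Kerr.axialVector (x - y) := by
  simp only [Kerr.axialVector, PiLp.sub_apply]
  module

/-- `K(x) − K(y) = ω₊ Φ(x − y)` for the Hawking field `K = ∂₀ + ω₊Φ`. [cite: DafermosRodnianskiShlapentokhrothman2014, §2.2.2] -/
theorem hawkingVector_sub (M a : ℝ) (x y : E4) :
    Kerr.hawkingVector M a x - Kerr.hawkingVector M a y =
      Kerr.horizonAngularVelocity M a • Kerr.axialVector (x - y) := by
  rw [← axialVector_sub, smul_sub, Kerr.hawkingVector, Kerr.hawkingVector]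
  abel

/-- `‖Φ(v)‖ ≤ ‖v‖`. [cite: DafermosRodnianskiShlapentokhrothman2014, §2.2.2] -/
theorem norm_axialVector_le (v : E4) : ‖Kerr.axialVector v‖ ≤ ‖v‖ := by
  have h1 := norm_sq_E4 (Kerr.axialVector v)
  have h2 := norm_sq_E4 v
  rw [Kerr.axialVector_apply_zero, axialVector_apply_one, axialVector_apply_two,
    axialVector_apply_three] at h1
  have h3 : ‖Kerr.axialVector v‖ ^ 2 ≤ ‖v‖ ^ 2 := by
    rw [h1, h2]; nlinarith [sq_nonneg (v 0), sq_nonneg (v 3)]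
  exact (pow_le_pow_iff_left₀ (norm_nonneg _) (norm_nonneg _) two_ne_zero).1 h3

/-- `x₁² + x₂² ≤ r² + a²` (from `(x² + y²)/(r² + a²) + z²/r² = 1`). [cite: arXiv07060622, (33)] -/
theorem sq_add_sq_le (a : ℝ) (hx : 0 < Kerr.radius a x) :
    x 1 ^ 2 + x 2 ^ 2 ≤ Kerr.radius a x ^ 2 + a ^ 2 := by
  rw [Kerr.sq_add_sq_eq a hx]
  have h3 := Kerr.sq_apply_three_le_radius_sq a hx
  have hr2 : 0 < Kerr.radius a x ^ 2 := by positivity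
  rw [div_le_iff₀ hr2]
  have : 0 ≤ Kerr.radius a x ^ 2 + a ^ 2 := by positivity
  nlinarith [sq_nonneg (x 3)]

/-- `‖Φ(x)‖ ≤ r + |a|` (`x₁² + x₂² ≤ r² + a²`). [cite: arXiv07060622, (33)] -/
theorem norm_axialVector_le_of_radius (a : ℝ) (hx : 0 < Kerr.radius a x) :
    ‖Kerr.axialVector x‖ ≤ Kerr.radius a x + |a| := by
  have h1 := norm_sq_E4 (Kerr.axialVector x)
  rw [Kerr.axialVector_apply_zero, axialVector_apply_one, axialVector_apply_two,
    axialVector_apply_three] at h1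
  have h2 := sq_add_sq_le a hx
  have h3 : ‖Kerr.axialVector x‖ ^ 2 ≤ (Kerr.radius a x + |a|) ^ 2 := by
    rw [h1]
    have ha2 : a ^ 2 = |a| ^ 2 := (sq_abs a).symm
    nlinarith [mul_nonneg hx.le (abs_nonneg a)]
  exact (pow_le_pow_iff_left₀ (norm_nonneg _) (by positivity) two_ne_zero).1 h3

/-- `‖K(x)‖ ≤ 1 + |ω₊| (r + |a|)`. [cite: DafermosRodnianskiShlapentokhrothman2014, §2.2.2] -/
theorem norm_hawkingVector_le (M a : ℝ) (hx : 0 < Kerr.radius a x) :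
    ‖Kerr.hawkingVector M a x‖ ≤ 1 + |Kerr.horizonAngularVelocity M a| * (Kerr.radius a x + |a|) := by
  unfold Kerr.hawkingVector
  refine (norm_add_le _ _).trans (add_le_add ?_ ?_)
  · simp [E4.basisVector]
  · rw [norm_smul, Real.norm_eq_abs]
    exact mul_le_mul_of_nonneg_left (norm_axialVector_le_of_radius a hx) (abs_nonneg _)

/-- `dr(K⃗) = 0`: the Hawking field `K = T + ω₊Φ` is tangent to the spheres `r = const`. [cite: DafermosRodnianskiShlapentokhrothman2014, §2.2.2] -/
theorem radiusGrad_spatial_hawkingVector (M a : ℝ) (x : E4) :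
    Kerr.radiusGrad a (E4.spatial x) (E4.spatial (Kerr.hawkingVector M a x)) = 0 := by
  rw [Kerr.radiusGrad_apply_eq]
  have h0 : (E4.spatial (Kerr.hawkingVector M a x)) 2 = 0 := by
    rw [E4.spatial_apply]
    show Kerr.hawkingVector M a x (Fin.succ 2) = 0
    rw [show (Fin.succ 2 : Fin 4) = 3 from rfl]
    simp [Kerr.hawkingVector, Kerr.axialVector]
  have hin : inner ℝ (E4.spatial x) (E4.spatial (Kerr.hawkingVector M a x)) = 0 := by
    rw [EuclideanSpace.inner_eq_star_dotProduct]
    simp [dotProduct, Fin.sum_univ_three, E4.spatial_apply, Kerr.hawkingVector, Kerr.axialVector]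
    ring
  rw [hin, h0]
  simp

/-- `K⁰ = 1`. [cite: DafermosRodnianskiShlapentokhrothman2014, §2.2.2] -/
theorem hawkingVector_apply_zero (M a : ℝ) (x : E4) : Kerr.hawkingVector M a x 0 = 1 := by
  simp [Kerr.hawkingVector, Kerr.axialVector]

/-- `K¹ = −ω₊ x²`. [cite: DafermosRodnianskiShlapentokhrothman2014, §2.2.2] -/
theorem hawkingVector_apply_one (M a : ℝ) (x : E4) :
    Kerr.hawkingVector M a x 1 = -(Kerr.horizonAngularVelocity M a * x 2) := by
  simp [Kerr.hawkingVector, Kerr.axialVector]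

/-- `K² = ω₊ x¹`. [cite: DafermosRodnianskiShlapentokhrothman2014, §2.2.2] -/
theorem hawkingVector_apply_two (M a : ℝ) (x : E4) :
    Kerr.hawkingVector M a x 2 = Kerr.horizonAngularVelocity M a * x 1 := by
  simp [Kerr.hawkingVector, Kerr.axialVector]

/-- `K³ = 0`. [cite: DafermosRodnianskiShlapentokhrothman2014, §2.2.2] -/
theorem hawkingVector_apply_three (M a : ℝ) (x : E4) : Kerr.hawkingVector M a x 3 = 0 := by
  simp [Kerr.hawkingVector, Kerr.axialVector]

/-- **`2H ℓ(K) = 1` on the horizon** (`2H = (r₊² + a²)/Σ`, `ℓ(K) = 1 − aω₊ sin²θ = Σ/(r₊² + a²)` at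
`r = r₊`). DRSR arXiv:1402.7034, §2.2.2. [cite: DafermosRodnianskiShlapentokhrothman2014, Lemma 4.7.2 (proof)] -/
theorem two_scalarH_nullCovector_hawking (h : |a| ≤ M) (hM : 0 < M)
    (hx : Kerr.radius a x = Kerr.rPlus M a) :
    2 * Kerr.scalarH M a x * Kerr.nullCovector a x (Kerr.hawkingVector M a x) = 1 := by
  have hp0 : 0 < Kerr.rPlus M a := lt_of_lt_of_le hM (le_add_of_nonneg_right (Real.sqrt_nonneg _))
  have hr0 : 0 < Kerr.radius a x := hx ▸ hp0
  have hA := Kerr.rPlus_sq_add_sq h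
  have h12 := Kerr.sq_add_sq_eq a hr0
  have hx3 : x 3 ^ 2 ≤ Kerr.radius a x ^ 2 := Kerr.sq_apply_three_le_radius_sq a hr0
  rw [Kerr.hawkingVector, map_add, map_smul, Kerr.nullCovector_basisVector_zero,
    Kerr.nullCovector_axialVector, smul_eq_mul, h12, Kerr.scalarH, Kerr.horizonAngularVelocity, hx]
  rw [hx] at hx3
  obtain ⟨p, hp⟩ : ∃ p, Kerr.rPlus M a = p := ⟨_, rfl⟩
  rw [hp] at hA hp0 hx3 ⊢
  have hD : p ^ 4 + a ^ 2 * x 3 ^ 2 ≠ 0 := by positivity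
  have hp2 : p ^ 2 + a ^ 2 ≠ 0 := by positivity
  have hM2 : M = (p ^ 2 + a ^ 2) / (2 * p) := by
    field_simp
    linarith
  subst hM2
  field_simp
  ring

/-- **The null cone is tangent to `{dr = 0}` along the generator**: at a horizon point,
`g(K, u) = (Σ/(r₊² + a²)) dr(u⃗)` for every `u` with `u⁰ = 0`. [cite: DafermosRodnianskiShlapentokhrothman2014, §2.2.2] -/
theorem bilin_hawkingVector_of_radius_eq (h : |a| ≤ M) (hM : 0 < M)
    (hx : Kerr.radius a x = Kerr.rPlus M a) (u : E4) (hu : u 0 = 0) :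
    Kerr.bilin M a x (Kerr.hawkingVector M a x) u =
      Kerr.blSigma a (E4.spatial x) / (Kerr.rPlus M a ^ 2 + a ^ 2) *
        Kerr.radiusGrad a (E4.spatial x) (E4.spatial u) := by
  have hp0 : 0 < Kerr.rPlus M a := lt_of_lt_of_le hM (le_add_of_nonneg_right (Real.sqrt_nonneg _))
  have hr0 : 0 < Kerr.radius a x := hx ▸ hp0
  have hA := Kerr.rPlus_sq_add_sq h
  have hkey := two_scalarH_nullCovector_hawking h hM hx
  have hS : Kerr.blSigma a (E4.spatial x) ≠ 0 := (Kerr.blSigma_spatial_pos hr0).ne'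
  rw [Kerr.bilin_apply, show 2 * Kerr.scalarH M a x * (Kerr.nullCovector a x (Kerr.hawkingVector M a x) *
      Kerr.nullCovector a x u) = (2 * Kerr.scalarH M a x * Kerr.nullCovector a x (Kerr.hawkingVector M a x)) *
      Kerr.nullCovector a x u by ring, hkey, one_mul]
  have hmink : Minkowski.bilin (Kerr.hawkingVector M a x) u =
      Kerr.horizonAngularVelocity M a * (x 1 * u 2 - x 2 * u 1) := by
    rw [Minkowski.bilin_apply, Fin.sum_univ_three]
    simp only [Fin.succ_zero_eq_one, Fin.succ_one_eq_two, show (Fin.succ (2 : Fin 3) : Fin 4) = 3 from rfl,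
      hawkingVector_apply_zero, hawkingVector_apply_one, hawkingVector_apply_two,
      hawkingVector_apply_three, hu]
    ring
  have hℓu : Kerr.nullCovector a x u =
      (Kerr.radius a x * x 1 + a * x 2) / (Kerr.radius a x ^ 2 + a ^ 2) * u 1 +
      (Kerr.radius a x * x 2 - a * x 1) / (Kerr.radius a x ^ 2 + a ^ 2) * u 2 +
      x 3 / Kerr.radius a x * u 3 := by
    rw [Kerr.nullCovector, E4.covector_apply, Fin.sum_univ_four, hu]
    simp [Kerr.nullCovectorFun]
  have hgrad : Kerr.radiusGrad a (E4.spatial x) (E4.spatial u) =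
      (Kerr.radius a x ^ 2 * (x 1 * u 1 + x 2 * u 2 + x 3 * u 3) + a ^ 2 * x 3 * u 3) /
        (Kerr.radius a x * Kerr.blSigma a (E4.spatial x)) := by
    rw [Kerr.radiusGrad_apply_sum, Fin.sum_univ_three]
    simp only [Kerr.radiusGradVec_apply, E4.spatial_apply, Kerr.radius_ofTimeSpace_spatial,
      Fin.succ_zero_eq_one, Fin.succ_one_eq_two, show (Fin.succ (2 : Fin 3) : Fin 4) = 3 from rfl]
    simp only [Fin.isValue, Fin.reduceEq, ↓reduceIte, add_zero]
    field_simp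
    ring
  rw [hmink, hℓu, hgrad, Kerr.horizonAngularVelocity, hx]
  obtain ⟨p, hp⟩ : ∃ p, Kerr.rPlus M a = p := ⟨_, rfl⟩
  rw [hp] at hA hp0 ⊢
  obtain ⟨S, hSdef⟩ : ∃ S, Kerr.blSigma a (E4.spatial x) = S := ⟨_, rfl⟩
  rw [hSdef] at hS ⊢
  rw [← hA]
  have hp2 : p ^ 2 + a ^ 2 ≠ 0 := by positivity
  field_simp
  ring

/-- **`K` is null on the horizon** (`r = r₊`). DRSR arXiv:1402.7034, §2.2.2. [cite: DafermosRodnianskiShlapentokhrothman2014, §2.2.2] -/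
theorem bilin_hawkingVector_self_of_radius_eq (h : |a| ≤ M) (hM : 0 < M)
    (hx : Kerr.radius a x = Kerr.rPlus M a) :
    Kerr.bilin M a x (Kerr.hawkingVector M a x) (Kerr.hawkingVector M a x) = 0 := by
  have hp0 : 0 < Kerr.rPlus M a := lt_of_lt_of_le hM (le_add_of_nonneg_right (Real.sqrt_nonneg _))
  have hr : 0 < Kerr.radius a x := hx ▸ hp0
  have hA := Kerr.rPlus_sq_add_sq h
  set σ : ℝ := (Kerr.radius a x ^ 2 - x 3 ^ 2) / Kerr.radius a x ^ 2 with hσ_def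
  obtain ⟨hσ0, hσ1⟩ := Kerr.sinSq_nonneg_and_le_one a hr
  rw [← hσ_def] at hσ0 hσ1
  rw [Kerr.hawkingVector, Kerr.bilin_basisVector_add_smul_axialVector M a _ hr, ← hσ_def, hx]
  have hD : 0 < Kerr.rPlus M a ^ 2 + a ^ 2 * (1 - σ) := by
    have : 0 ≤ a ^ 2 * (1 - σ) := mul_nonneg (sq_nonneg a) (by linarith)
    positivity
  have hF := Kerr.hawking_F_factor h hM (Kerr.rPlus M a)
  rw [sub_self, zero_mul] at hF
  have hΔ : Kerr.rPlus M a ^ 2 - 2 * M * Kerr.rPlus M a + a ^ 2 = 0 := by linarith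
  refine (mul_eq_zero.1 ?_).resolve_left hD.ne'
  rw [Kerr.hawking_rho_sq_mul_eq (by positivity) hD.ne', hΔ]
  have hA' : a ^ 2 - 2 * a ^ 2 * Kerr.rPlus M a / Kerr.rPlus M a +
      a ^ 2 * (Kerr.rPlus M a ^ 2 + a ^ 2) ^ 2 / (4 * M ^ 2 * Kerr.rPlus M a ^ 2) = 0 := by
    linarith [hF, hΔ]
  rw [mul_zero, zero_div, sub_zero, hA']
  ring

/-- **KerrHorizonRedShiftLinear.** For sub-extremal `(M, a)` there are `d₁, c₀ > 0` with
`g(K, K) ≤ −c₀ (r − r₊)` on the collar `r₊ ≤ r ≤ r₊ + d₁` (`K = ∂₀ + ω₊(x₁∂₂ − x₂∂₁)` the Hawking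
field): `ρ² g(K,K) = −(1 − σ)Δ + σ (r − r₊) G(r) − σ²a⁴Δ/(4M²r₊²)` with `Δ ≥ (r₊ − r₋)(r − r₊)`,
`G(r₊) = −2κ·(…) < 0`. DRSR arXiv:1402.7034, Lemma 4.7.2 (positivity of the surface gravity). [cite: DafermosRodnianskiShlapentokhrothman2014, Lemma 4.7.2] -/
theorem bilin_hawkingVector_self_le_linear (hMa : Kerr.IsSubextremal M a) :
    ∃ d₁ : ℝ, 0 < d₁ ∧ ∃ c₀ : ℝ, 0 < c₀ ∧ ∀ x : E4, Kerr.rPlus M a ≤ Kerr.radius a x →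
      Kerr.radius a x ≤ Kerr.rPlus M a + d₁ →
      Kerr.bilin M a x (Kerr.hawkingVector M a x) (Kerr.hawkingVector M a x) ≤
        -(c₀ * (Kerr.radius a x - Kerr.rPlus M a)) := by
  have hM := hMa.pos
  have hle : |a| ≤ M := hMa.le
  have hrp : 0 < Kerr.rPlus M a := lt_of_lt_of_le hM (le_add_of_nonneg_right (Real.sqrt_nonneg _))
  have ha2 : a ^ 2 < M ^ 2 := sq_lt_sq' (abs_lt.1 hMa).1 (abs_lt.1 hMa).2
  have hs : 0 < √(M ^ 2 - a ^ 2) := Real.sqrt_pos.2 (by linarith)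
  have hs2 : √(M ^ 2 - a ^ 2) ^ 2 = M ^ 2 - a ^ 2 := Real.sq_sqrt (by linarith)
  have hrps : Kerr.rPlus M a = M + √(M ^ 2 - a ^ 2) := rfl
  set s := √(M ^ 2 - a ^ 2) with hs_def
  -- the cubic `G` and a right-collar on which `G ≤ G(r₊)/2 < 0`
  set G : ℝ → ℝ := fun r ↦ -(r + Kerr.rPlus M a) + 2 * M - 2 * a ^ 2 / Kerr.rPlus M a +
    a ^ 2 * (r + Kerr.rPlus M a) * (r ^ 2 + Kerr.rPlus M a ^ 2 + 2 * a ^ 2) / (4 * M ^ 2 * Kerr.rPlus M a ^ 2)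
    with hG_def
  have hGc : Continuous G := by
    simp only [hG_def]
    fun_prop
  have hG0 : G (Kerr.rPlus M a) < 0 := by
    simp only [hG_def]
    exact Kerr.hawking_G_rPlus_neg hMa
  obtain ⟨g₀, hg₀⟩ : ∃ g₀, G (Kerr.rPlus M a) = g₀ := ⟨_, rfl⟩
  have hg₀neg : g₀ < 0 := hg₀ ▸ hG0
  have hlt : G (Kerr.rPlus M a) < g₀ / 2 := by rw [hg₀]; linarith
  obtain ⟨ε₀, hε₀, hε⟩ := Metric.eventually_nhds_iff.1
    (hGc.continuousAt.eventually (eventually_lt_nhds hlt))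
  -- constants
  obtain ⟨m, hmdef⟩ : ∃ m : ℝ, m = min (2 * s) (-g₀ / 2) := ⟨_, rfl⟩
  have hm0 : 0 < m := by rw [hmdef]; exact lt_min (by positivity) (by linarith)
  have hm1 : m ≤ 2 * s := by rw [hmdef]; exact min_le_left _ _
  have hm2 : m ≤ -g₀ / 2 := by rw [hmdef]; exact min_le_right _ _
  obtain ⟨Dm, hDmdef⟩ : ∃ Dm : ℝ, Dm = (Kerr.rPlus M a + ε₀ / 2) ^ 2 + a ^ 2 := ⟨_, rfl⟩
  have hDm0 : 0 < Dm := by rw [hDmdef]; positivity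
  refine ⟨ε₀ / 2, by positivity, m / Dm, by positivity, fun x hx1 hx2 => ?_⟩
  have hr : 0 < Kerr.radius a x := hrp.trans_le hx1
  set r := Kerr.radius a x with hr_def
  have hGr : G r ≤ g₀ / 2 :=
    (hε (by rw [Real.dist_eq, abs_lt]; constructor <;> linarith)).le
  simp only [hG_def] at hGr
  -- `σ = sin²θ ∈ [0, 1]`, `ρ² > 0`, `Δ ≥ 2s (r − r₊) ≥ 0`
  set σ : ℝ := (r ^ 2 - x 3 ^ 2) / r ^ 2 with hσ_def
  obtain ⟨hσ0, hσ1⟩ := Kerr.sinSq_nonneg_and_le_one a hr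
  rw [← hr_def, ← hσ_def] at hσ0 hσ1
  have hD : 0 < r ^ 2 + a ^ 2 * (1 - σ) := by
    have : 0 ≤ a ^ 2 * (1 - σ) := mul_nonneg (sq_nonneg a) (by linarith)
    positivity
  have hDle : r ^ 2 + a ^ 2 * (1 - σ) ≤ Dm := by
    rw [hDmdef]
    have h1 : a ^ 2 * (1 - σ) ≤ a ^ 2 := by nlinarith [sq_nonneg a]
    have h2 : r ^ 2 ≤ (Kerr.rPlus M a + ε₀ / 2) ^ 2 := pow_le_pow_left₀ hr.le hx2 2
    linarith
  have hΔeq : r ^ 2 - 2 * M * r + a ^ 2 = (r - Kerr.rPlus M a) ^ 2 + 2 * s * (r - Kerr.rPlus M a) := by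
    rw [hrps]
    linear_combination hs2
  have ht0 : 0 ≤ r - Kerr.rPlus M a := sub_nonneg.2 hx1
  have hΔge : 2 * s * (r - Kerr.rPlus M a) ≤ r ^ 2 - 2 * M * r + a ^ 2 := by
    rw [hΔeq]; nlinarith
  have hΔ0 : 0 ≤ r ^ 2 - 2 * M * r + a ^ 2 := le_trans (by positivity) hΔge
  have hF := Kerr.hawking_F_factor hle hM r
  have hlast : 0 ≤ a ^ 4 * σ * (r ^ 2 - 2 * M * r + a ^ 2) / (4 * M ^ 2 * Kerr.rPlus M a ^ 2) :=
    div_nonneg (mul_nonneg (mul_nonneg (by positivity) hσ0) hΔ0) (by positivity)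
  -- the printed right-hand side is `≤ −m (r − r₊)`
  have hrhs : -(r ^ 2 - 2 * M * r + a ^ 2) + σ * (a ^ 2 - 2 * a ^ 2 * r / Kerr.rPlus M a +
      a ^ 2 * (r ^ 2 + a ^ 2) ^ 2 / (4 * M ^ 2 * Kerr.rPlus M a ^ 2) -
      a ^ 4 * σ * (r ^ 2 - 2 * M * r + a ^ 2) / (4 * M ^ 2 * Kerr.rPlus M a ^ 2)) ≤
      -(m * (r - Kerr.rPlus M a)) := by
    have e : -(r ^ 2 - 2 * M * r + a ^ 2) + σ * (a ^ 2 - 2 * a ^ 2 * r / Kerr.rPlus M a +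
        a ^ 2 * (r ^ 2 + a ^ 2) ^ 2 / (4 * M ^ 2 * Kerr.rPlus M a ^ 2) -
        a ^ 4 * σ * (r ^ 2 - 2 * M * r + a ^ 2) / (4 * M ^ 2 * Kerr.rPlus M a ^ 2)) =
        -((1 - σ) * (r ^ 2 - 2 * M * r + a ^ 2)) +
        σ * (-(r ^ 2 - 2 * M * r + a ^ 2) + (a ^ 2 - 2 * a ^ 2 * r / Kerr.rPlus M a +
          a ^ 2 * (r ^ 2 + a ^ 2) ^ 2 / (4 * M ^ 2 * Kerr.rPlus M a ^ 2))) -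
        σ * (a ^ 4 * σ * (r ^ 2 - 2 * M * r + a ^ 2) / (4 * M ^ 2 * Kerr.rPlus M a ^ 2)) := by
      ring
    rw [e, hF]
    have h1 : (1 - σ) * (2 * s * (r - Kerr.rPlus M a)) ≤ (1 - σ) * (r ^ 2 - 2 * M * r + a ^ 2) :=
      mul_le_mul_of_nonneg_left hΔge (by linarith)
    have h2 : σ * ((r - Kerr.rPlus M a) * (-(r + Kerr.rPlus M a) + 2 * M - 2 * a ^ 2 / Kerr.rPlus M a +
        a ^ 2 * (r + Kerr.rPlus M a) * (r ^ 2 + Kerr.rPlus M a ^ 2 + 2 * a ^ 2) /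
          (4 * M ^ 2 * Kerr.rPlus M a ^ 2))) ≤ σ * ((r - Kerr.rPlus M a) * (g₀ / 2)) :=
      mul_le_mul_of_nonneg_left (mul_le_mul_of_nonneg_left hGr ht0) hσ0
    have h3 : 0 ≤ σ * (a ^ 4 * σ * (r ^ 2 - 2 * M * r + a ^ 2) / (4 * M ^ 2 * Kerr.rPlus M a ^ 2)) :=
      mul_nonneg hσ0 hlast
    have h4 : (r - Kerr.rPlus M a) * ((1 - σ) * m) ≤ (r - Kerr.rPlus M a) * ((1 - σ) * (2 * s)) :=
      mul_le_mul_of_nonneg_left (mul_le_mul_of_nonneg_left hm1 (by linarith)) ht0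
    have h5 : (r - Kerr.rPlus M a) * (σ * m) ≤ (r - Kerr.rPlus M a) * (σ * (-g₀ / 2)) :=
      mul_le_mul_of_nonneg_left (mul_le_mul_of_nonneg_left hm2 hσ0) ht0
    linarith [h1, h2, h3, h4, h5]
  -- finish: `g(K,K) = RHS/ρ²`
  rw [Kerr.hawkingVector, Kerr.bilin_basisVector_add_smul_axialVector M a _ hr, ← hr_def, ← hσ_def]
  refine le_of_mul_le_mul_left ?_ hD
  rw [Kerr.hawking_rho_sq_mul_eq (by positivity) hD.ne']
  refine hrhs.trans ?_
  have h7 : m * (r - Kerr.rPlus M a) * ((r ^ 2 + a ^ 2 * (1 - σ)) / Dm) ≤ m * (r - Kerr.rPlus M a) :=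
    mul_le_of_le_one_right (mul_nonneg hm0.le ht0) ((div_le_one hDm0).2 hDle)
  have e7 : (r ^ 2 + a ^ 2 * (1 - σ)) * -(m / Dm * (r - Kerr.rPlus M a)) =
      -(m * (r - Kerr.rPlus M a) * ((r ^ 2 + a ^ 2 * (1 - σ)) / Dm)) := by ring
  rw [e7]
  linarith [h7]

/-! #### The outgoing spatial null direction `n = (0, ℓ⃗)` -/

/-- `n_x := (0, ℓ⃗ₓ)`. [cite: arXiv07060622, (32)] -/
def nvec (a : ℝ) (x : E4) : E4 := E4.ofTimeSpace 0 (Kerr.nullSpatial a x)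

/-- `n⁰ = 0`. [cite: arXiv07060622, (32)] -/
theorem nvec_apply_zero (a : ℝ) (x : E4) : nvec a x 0 = 0 := E4.ofTimeSpace_apply_zero 0 _

/-- `n^{i+1} = ℓ^{i+1}`: the spatial components of `n` are those of `ℓ♯`. [cite: arXiv07060622, (32)] -/
theorem nvec_apply_succ (a : ℝ) (x : E4) (i : Fin 3) : nvec a x i.succ = Kerr.nullVector a x i.succ := by
  rw [nvec, E4.ofTimeSpace_apply_succ, Kerr.nullSpatial, E4.spatial_apply]

/-- The spatial part of `n` is `ℓ⃗`. [cite: arXiv07060622, (32)] -/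
theorem spatial_nvec (a : ℝ) (x : E4) : E4.spatial (nvec a x) = Kerr.nullSpatial a x :=
  E4.spatial_ofTimeSpace 0 _

/-- `n = ℓ♯ + e₀` (`(ℓ♯)⁰ = −1`). [cite: arXiv07060622, (32)] -/
theorem nvec_eq (a : ℝ) (x : E4) : nvec a x = Kerr.nullVector a x + E4.basisVector 0 := by
  ext i
  refine Fin.cases ?_ (fun j => ?_) i
  · rw [nvec_apply_zero, PiLp.add_apply, Kerr.nullVector_apply_zero]
    simp
  · rw [nvec_apply_succ, PiLp.add_apply]
    simp [Fin.succ_ne_zero]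

/-- `‖n‖ = 1` (`|ℓ⃗|² = ℓ₀² = 1` since `ℓ` is null). [cite: arXiv07060622, (32)] -/
theorem norm_nvec (hx : 0 < Kerr.radius a x) : ‖nvec a x‖ = 1 := by
  have h0 := Kerr.nullCovector_nullVector hx
  rw [← Kerr.bilin_nullVector, minkowski_self_eq, Kerr.nullVector_apply_zero] at h0
  have h1 := norm_sq_E4 (Kerr.nullVector a x)
  have h2 := norm_sq_E4 (nvec a x)
  rw [nvec_apply_zero, show (1 : Fin 4) = Fin.succ 0 from rfl, show (2 : Fin 4) = Fin.succ 1 from rfl,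
    show (3 : Fin 4) = Fin.succ 2 from rfl, nvec_apply_succ, nvec_apply_succ, nvec_apply_succ] at h2
  rw [show (1 : Fin 4) = Fin.succ 0 from rfl, show (2 : Fin 4) = Fin.succ 1 from rfl,
    show (3 : Fin 4) = Fin.succ 2 from rfl, Kerr.nullVector_apply_zero] at h1
  have h3 : ‖nvec a x‖ ^ 2 = 1 := by nlinarith [h0, h1, h2]
  have h4 := norm_nonneg (nvec a x)
  nlinarith [h3, h4]

/-- **Radius along the outgoing spatial null direction**: `r(x + s n) = r(x) + s` for `r(x) + s > 0`
(`r(x + sℓ♯) = r(x) + s` and `t*`-independence). Kerr–Schild 1965, §2. [cite: arXiv07060622, (32)–(33)] -/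
theorem radius_add_smul_nvec (hx : 0 < Kerr.radius a x) {s : ℝ} (hs : 0 < Kerr.radius a x + s) :
    Kerr.radius a (x + s • nvec a x) = Kerr.radius a x + s := by
  rw [nvec_eq, smul_add, ← add_assoc]
  have h := Kerr.radius_add_smul_nullVector hx hs
  rw [← Kerr.radius_ofTimeSpace_spatial a (x + s • Kerr.nullVector a x + s • E4.basisVector 0),
    ← Kerr.radius_ofTimeSpace_spatial a (x + s • Kerr.nullVector a x)] at *
  rw [← h]
  congr 2
  ext i
  simp [E4.spatial_apply]

/-- `(x + s n)⁰ = x⁰`. [cite: arXiv07060622, (32)] -/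
theorem add_smul_nvec_apply_zero (a : ℝ) (x : E4) (s : ℝ) : (x + s • nvec a x) 0 = x 0 := by
  simp [nvec_apply_zero]

/-- `dr(n⃗) = 1`. [cite: arXiv07060622, (32)–(33)] -/
theorem radiusGrad_spatial_nvec (hx : 0 < Kerr.radius a x) :
    Kerr.radiusGrad a (E4.spatial x) (E4.spatial (nvec a x)) = 1 := by
  rw [spatial_nvec]
  have h := Kerr.radiusGrad_nullSpatial (a := a) (E4.time x) (y := E4.spatial x)
    (by rwa [Kerr.radius_ofTimeSpace_spatial])
  rwa [E4.ofTimeSpace_time_spatial] at h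

/-- LEAK POINT (i) of critic row 342 — **the cross term has the unfavourable sign.**  On the horizon
`r = r₊` the outgoing spatial null direction `n` has `g(K, n) = Σ/(r₊² + a²) > 0`: in
`g(K + e + μd·n, K + e + μd·n)` the cross term `2μd·g(K, n)` is POSITIVE, of size `O(μd)`, and can
only be paid from the red-shift budget `g(K, K) ≤ −c₀ d` by taking `μ` small (`μ = c₀/(8 C_G C_K)`
in `layer_slope`) — never by a sign argument. [cite: DafermosRodnianskiShlapentokhrothman2014, §2.2.2] -/
theorem bilin_hawkingVector_nvec_of_radius_eq (h : |a| ≤ M) (hM : 0 < M)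
    (hx : Kerr.radius a x = Kerr.rPlus M a) :
    Kerr.bilin M a x (Kerr.hawkingVector M a x) (nvec a x) =
      Kerr.blSigma a (E4.spatial x) / (Kerr.rPlus M a ^ 2 + a ^ 2) := by
  have hp0 : 0 < Kerr.rPlus M a := lt_of_lt_of_le hM (le_add_of_nonneg_right (Real.sqrt_nonneg _))
  have hr0 : 0 < Kerr.radius a x := hx ▸ hp0
  rw [bilin_hawkingVector_of_radius_eq h hM hx (nvec a x) (nvec_apply_zero a x),
    radiusGrad_spatial_nvec hr0, mul_one]

/-- The cross term is STRICTLY positive on the horizon (`Σ > 0`, `r₊ > 0`). [cite: DafermosRodnianskiShlapentokhrothman2014, §2.2.2] -/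
theorem bilin_hawkingVector_nvec_pos_of_radius_eq (h : |a| ≤ M) (hM : 0 < M)
    (hx : Kerr.radius a x = Kerr.rPlus M a) :
    0 < Kerr.bilin M a x (Kerr.hawkingVector M a x) (nvec a x) := by
  have hp0 : 0 < Kerr.rPlus M a := lt_of_lt_of_le hM (le_add_of_nonneg_right (Real.sqrt_nonneg _))
  have hr0 : 0 < Kerr.radius a x := hx ▸ hp0
  rw [bilin_hawkingVector_nvec_of_radius_eq h hM hx]
  exact div_pos (Kerr.blSigma_spatial_pos hr0) (by positivity)

/-! ### §3 The bulk `r₊ + d₁ ≤ r ≤ r₊ + h`: the future timelike vector `u = V + (4HΣ/Δ) W` -/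

/-- `u := V + (4HΣ/Δ) W` (`V = −(dt*)♯ … the Kerr–Schild time vector, `W = (dr)♯`):
`g(u, u) = −1 − 2H`, `dr(u) = g(W, u) = 2H > 0`, `u⁰ = 1 + 2H + (4HΣ/Δ)·2H ≥ 1` off the horizons.
[cite: arXiv07060622, (32)–(33)] -/
def bulkVec (M a : ℝ) (x : E4) : E4 :=
  Kerr.timeVector M a x +
    (4 * Kerr.scalarH M a x * Kerr.blSigma a (E4.spatial x) /
      (Kerr.radius a x ^ 2 - 2 * M * Kerr.radius a x + a ^ 2)) • Kerr.radiusGradVector M a x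

/-- `u⁰ = V⁰ = 1 + 2H` (the `W`-correction is spatial up to `−2H ℓ♯`-terms already in `V`). [cite: arXiv07060622, (32)–(33)] -/
theorem bulkVec_apply_zero (M a : ℝ) (x : E4) :
    bulkVec M a x 0 = 1 + 2 * Kerr.scalarH M a x +
      4 * Kerr.scalarH M a x * Kerr.blSigma a (E4.spatial x) /
        (Kerr.radius a x ^ 2 - 2 * M * Kerr.radius a x + a ^ 2) * (2 * Kerr.scalarH M a x) := by
  -- `V⁰ = 1 + 2H` is `Kerr.timeVector_apply_zero` of `KerrDeSitterData` (not imported for one line)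
  have hV0 : Kerr.timeVector M a x 0 = 1 + 2 * Kerr.scalarH M a x := by
    simp [Kerr.timeVector, Kerr.nullVector, Kerr.nullCovectorFun]
  rw [bulkVec, PiLp.add_apply, PiLp.smul_apply, hV0, Kerr.radiusGradVector_apply_zero, smul_eq_mul]

/-- `g(u, u) = −1 − 2H`. [cite: arXiv07060622, (32)–(33)] -/
theorem bulkVec_self (hx : 0 < Kerr.radius a x)
    (hΔ : Kerr.radius a x ^ 2 - 2 * M * Kerr.radius a x + a ^ 2 ≠ 0) :
    Kerr.bilin M a x (bulkVec M a x) (bulkVec M a x) = -1 - 2 * Kerr.scalarH M a x := by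
  have hS := (Kerr.blSigma_spatial_pos hx).ne'
  have hWV : Kerr.bilin M a x (Kerr.radiusGradVector M a x) (Kerr.timeVector M a x) =
      -(2 * Kerr.scalarH M a x) := by
    rw [Kerr.bilin_symm, Kerr.bilin_timeVector_radiusGradVector hx]
  obtain ⟨s, hs⟩ : ∃ s, 4 * Kerr.scalarH M a x * Kerr.blSigma a (E4.spatial x) /
      (Kerr.radius a x ^ 2 - 2 * M * Kerr.radius a x + a ^ 2) = s := ⟨_, rfl⟩
  have hsΔ : s * (Kerr.radius a x ^ 2 - 2 * M * Kerr.radius a x + a ^ 2) =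
      4 * Kerr.scalarH M a x * Kerr.blSigma a (E4.spatial x) := by
    rw [← hs]; exact div_mul_cancel₀ _ hΔ
  rw [bulkVec, hs]
  simp only [map_add, map_smul, add_apply, smul_apply, smul_eq_mul]
  rw [Kerr.bilin_timeVector_timeVector hx, Kerr.bilin_timeVector_radiusGradVector hx, hWV,
    Kerr.bilin_radiusGradVector_self hx]
  have h1 : s * (s * ((Kerr.radius a x ^ 2 - 2 * M * Kerr.radius a x + a ^ 2) /
      Kerr.blSigma a (E4.spatial x))) = s * (4 * Kerr.scalarH M a x) := by
    rw [← mul_div_assoc, hsΔ, mul_div_assoc, div_self hS, mul_one]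
  linear_combination h1

/-- `dr(u) = g(W, u) = 2H`. [cite: arXiv07060622, (32)–(33)] -/
theorem bilin_radiusGradVector_bulkVec (hx : 0 < Kerr.radius a x)
    (hΔ : Kerr.radius a x ^ 2 - 2 * M * Kerr.radius a x + a ^ 2 ≠ 0) :
    Kerr.bilin M a x (Kerr.radiusGradVector M a x) (bulkVec M a x) = 2 * Kerr.scalarH M a x := by
  have hS := (Kerr.blSigma_spatial_pos hx).ne'
  have hWV : Kerr.bilin M a x (Kerr.radiusGradVector M a x) (Kerr.timeVector M a x) =
      -(2 * Kerr.scalarH M a x) := by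
    rw [Kerr.bilin_symm, Kerr.bilin_timeVector_radiusGradVector hx]
  obtain ⟨s, hs⟩ : ∃ s, 4 * Kerr.scalarH M a x * Kerr.blSigma a (E4.spatial x) /
      (Kerr.radius a x ^ 2 - 2 * M * Kerr.radius a x + a ^ 2) = s := ⟨_, rfl⟩
  have hsΔ : s * (Kerr.radius a x ^ 2 - 2 * M * Kerr.radius a x + a ^ 2) =
      4 * Kerr.scalarH M a x * Kerr.blSigma a (E4.spatial x) := by
    rw [← hs]; exact div_mul_cancel₀ _ hΔ
  rw [bulkVec, hs, map_add, map_smul, smul_eq_mul, hWV, Kerr.bilin_radiusGradVector_self hx,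
    ← mul_div_assoc, hsΔ, mul_div_assoc, div_self hS, mul_one]
  ring

/-- The bulk vector is `t*`-independent: `u(tn x) = u(x)`. [cite: arXiv07060622, (32)–(33)] -/
theorem bulkVec_tn (M a : ℝ) (x : E4) : bulkVec M a (tn x) = bulkVec M a x := by
  unfold bulkVec
  rw [timeVector_tn, radiusGradVector_tn, scalarH_tn, radius_tn, spatial_tn]

/-- `x ↦ u_x` is continuous wherever `r > 0` and `Δ ≠ 0`-free data enter continuously (`r₊ + d₁ ≤ r`). [cite: arXiv07060622, (32)–(33)] -/
theorem continuousAt_bulkVec (M a : ℝ) (hx : 0 < Kerr.radius a x)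
    (hΔ : Kerr.radius a x ^ 2 - 2 * M * Kerr.radius a x + a ^ 2 ≠ 0) :
    ContinuousAt (bulkVec M a) x := by
  have hH : ContinuousAt (Kerr.scalarH M a) x := (Kerr.contDiffAt_scalarH M a hx (n := 0)).continuousAt
  have hr : ContinuousAt (Kerr.radius a) x := (Kerr.continuous_radius a).continuousAt
  have hSig : ContinuousAt (fun y : E4 => Kerr.blSigma a (E4.spatial y)) x :=
    (continuous_blSigma_spatial a).continuousAt
  have hc : ContinuousAt (fun y : E4 => 4 * Kerr.scalarH M a y * Kerr.blSigma a (E4.spatial y) /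
      (Kerr.radius a y ^ 2 - 2 * M * Kerr.radius a y + a ^ 2)) x :=
    ((continuousAt_const.mul hH).mul hSig).div
      (((hr.pow 2).sub (continuousAt_const.mul hr)).add continuousAt_const) hΔ
  unfold bulkVec
  exact (continuousAt_timeVector M a hx).add (hc.smul (continuousAt_radiusGradVector M a hx))

/-- `Δ(r) ≥ d₁²` for `r ≥ r₊ + d₁` when `|a| ≤ M` (`Δ = (r − M)² − (M² − a²)`, `r₊ − M = √(M² − a²)`).
[cite: ONeill1995, §2.5] -/
theorem delta_ge (h : |a| ≤ M) {d₁ r : ℝ} (hd₁ : 0 ≤ d₁) (hr : Kerr.rPlus M a + d₁ ≤ r) :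
    d₁ ^ 2 ≤ r ^ 2 - 2 * M * r + a ^ 2 := by
  have ha2 : a ^ 2 ≤ M ^ 2 := by
    have := abs_le.1 h
    nlinarith [abs_nonneg a, sq_abs a]
  have hs2 : √(M ^ 2 - a ^ 2) ^ 2 = M ^ 2 - a ^ 2 := Real.sq_sqrt (by linarith)
  have hs0 : 0 ≤ √(M ^ 2 - a ^ 2) := Real.sqrt_nonneg _
  have hrps : Kerr.rPlus M a = M + √(M ^ 2 - a ^ 2) := rfl
  rw [hrps] at hr
  nlinarith [hs2, hs0, hr]

/-! ### §4 The radius differential and the outgoing ray `s ↦ q + s n` through a collar point -/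

/-! #### The radius differential as a Fréchet derivative -/

/-- `dr_x(z) = ∇r(x⃗)·z⃗`: the Fréchet derivative of the Kerr–Schild radius is the spatial radius gradient. [cite: arXiv07060622, (33)] -/
theorem fderiv_radius_apply (hx : 0 < Kerr.radius a x) (z : E4) :
    fderiv ℝ (Kerr.radius a) x z = Kerr.radiusGrad a (E4.spatial x) (E4.spatial z) := by
  rw [(Kerr.hasFDerivAt_radius hx).fderiv, ContinuousLinearMap.comp_apply]

/-- The radius differential is `t*`-independent: `dr_{tn x} = dr_x`. [cite: arXiv07060622, (33)] -/
theorem fderiv_radius_tn (hx : 0 < Kerr.radius a x) :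
    fderiv ℝ (Kerr.radius a) (tn x) = fderiv ℝ (Kerr.radius a) x := by
  have hx' : 0 < Kerr.radius a (tn x) := by rwa [radius_tn]
  rw [(Kerr.hasFDerivAt_radius hx).fderiv, (Kerr.hasFDerivAt_radius hx').fderiv, spatial_tn]

/-- `x ↦ dr_x` is smooth wherever `r > 0`. [cite: arXiv07060622, (33)] -/
theorem contDiffAt_fderiv_radius (hx : 0 < Kerr.radius a x) :
    ContDiffAt ℝ 1 (fderiv ℝ (Kerr.radius a)) x :=
  (Kerr.contDiffAt_radius hx (n := 2)).fderiv_right (m := 1) (by norm_num)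

/-! #### The outgoing ray `s ↦ q + s n` through a collar point, time-normalised -/

/-- `tn n = n` (`n⁰ = 0`). [cite: arXiv07060622, (32)] -/
theorem tn_nvec (a : ℝ) (x : E4) : tn (nvec a x) = nvec a x := by
  rw [tn_eq, nvec_apply_zero, zero_smul, sub_zero]

/-- `tn (q + s n) = tn q + s n` (`n⁰ = 0`). [cite: arXiv07060622, (32)] -/
theorem tn_add_smul_nvec (a : ℝ) (q : E4) (s : ℝ) : tn (q + s • nvec a q) = tn q + s • nvec a q := by
  rw [tn_add_smul, tn_nvec]

/-- The time-normalised ray segment `{(0, q⃗ + s ℓ⃗) : −d ≤ s ≤ 0}` through a point with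
`r(q) = r₊ + d` lies in the shell `r₊ ≤ r ≤ R` (`R ≥ r₊ + d`). Kerr–Schild 1965, §2. [cite: arXiv07060622, (32)–(33)] -/
theorem tn_ray_mem_shell {q : E4} {rp d R : ℝ} (hrp : 0 < rp) (hq : Kerr.radius a q = rp + d)
    (hd : 0 ≤ d) (hR : rp + d ≤ R) {s : ℝ} (hs1 : -d ≤ s) (hs2 : s ≤ 0) :
    tn (q + s • nvec a q) ∈ shell a rp R := by
  have hq0 : 0 < Kerr.radius a q := by rw [hq]; linarith
  have hr : Kerr.radius a (q + s • nvec a q) = Kerr.radius a q + s :=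
    radius_add_smul_nvec hq0 (by rw [hq]; linarith)
  refine ⟨tn_apply_zero _, ?_, ?_⟩
  · rw [radius_tn, hr, hq]; linarith
  · rw [radius_tn, hr, hq]; linarith

/-- The segment from the time-normalised foot point `(0, q⃗ − dℓ⃗)` to `(0, q⃗)` lies in the shell. [cite: arXiv07060622, (32)–(33)] -/
theorem segment_ray_subset_shell {q : E4} {rp d R : ℝ} (hrp : 0 < rp) (hq : Kerr.radius a q = rp + d)
    (hd : 0 ≤ d) (hR : rp + d ≤ R) :
    segment ℝ (tn (q + (-d) • nvec a q)) (tn q) ⊆ shell a rp R := by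
  rw [segment_eq_image']
  rintro _ ⟨θ, ⟨hθ0, hθ1⟩, rfl⟩
  have h1 : tn (q + (-d) • nvec a q) + θ • (tn q - tn (q + (-d) • nvec a q)) =
      tn (q + (-d + θ * d) • nvec a q) := by
    rw [tn_add_smul_nvec, tn_add_smul_nvec]
    module
  show tn (q + (-d) • nvec a q) + θ • (tn q - tn (q + (-d) • nvec a q)) ∈ shell a rp R
  rw [h1]
  exact tn_ray_mem_shell hrp hq hd hR (by nlinarith) (by nlinarith)

/-- `‖tn q − tn (q − d n)‖ = d` for `d ≥ 0` (`‖n‖ = 1`). [cite: arXiv07060622, (32)] -/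
theorem norm_tn_sub_tn_foot {q : E4} (hq : 0 < Kerr.radius a q) {d : ℝ} (hd : 0 ≤ d) :
    ‖tn q - tn (q + (-d) • nvec a q)‖ = d := by
  rw [tn_add_smul_nvec, show tn q - (tn q + (-d) • nvec a q) = d • nvec a q by module, norm_smul,
    norm_nvec hq, mul_one, Real.norm_eq_abs, abs_of_nonneg hd]

/-- `K_q − K_{q − dn} = ω₊ · d · (n₁∂₂ − n₂∂₁)`, of norm `≤ |ω₊| d`. [cite: DafermosRodnianskiShlapentokhrothman2014, §2.2.2] -/
theorem norm_hawkingVector_sub_foot (M a : ℝ) {q : E4} (hq : 0 < Kerr.radius a q) {d : ℝ} (hd : 0 ≤ d) :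
    ‖Kerr.hawkingVector M a q - Kerr.hawkingVector M a (q + (-d) • nvec a q)‖ ≤
      |Kerr.horizonAngularVelocity M a| * d := by
  rw [hawkingVector_sub, show q - (q + (-d) • nvec a q) = d • nvec a q by module, norm_smul,
    Real.norm_eq_abs]
  refine mul_le_mul_of_nonneg_left ?_ (abs_nonneg _)
  calc ‖Kerr.axialVector (d • nvec a q)‖ ≤ ‖d • nvec a q‖ := norm_axialVector_le _
    _ = d := by rw [norm_smul, norm_nvec hq, mul_one, Real.norm_eq_abs, abs_of_nonneg hd]

end KerrSlope

end Literature.Geometry.Lorentzian
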